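import Summits.NavierStokesRegularity.NavierStokesRegularity.Theorems.TypeICertificateLadderRungReynoldsOneWeightedSlice
import Literature.Analysis.FluidPDE.TaoEnstrophyLocalisationProofs

/-!
# Crux `Target` (stmt-NavierStokesRegularity-1217), line `depletion-ladder` at `q = 5/2`: the
# DEPLETED weighted `L^{5/2}` vorticity slice inequality

`--supports stmt-NavierStokesRegularity-1217`. Rung one's slice (`RungReynoldsOne.weightedSlice_budget`,
`wt = (|ω|²+1)^{1/4}`, `Φ(ω) = wt ω`) absorbs the stretching density
`⟪D(Φ∘ω)(ω), v⟫ = wt⟪(ω·∇)ω, v⟫ + τ⟪ω,(ω·∇)ω⟫⟪ω, v⟫` (`τ = wt/(2(|ω|²+1))`) POINTWISE by Young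
into the viscous pieces `wt Σᵢ|∂ᵢω|²`, `τ Σᵢ⟪ω, ∂ᵢω⟫²` (factor `(1 + 1/2)/4 = 3/8`). Here the first
piece, the weighted Lamb pairing `𝒜 = ∫ wt⟪(ω·∇)ω, v⟫`, is bounded GLOBALLY by a depletion
hypothesis `|𝒜| ≤ κ·M·(∫wt|ω|²)^{1/2}(∫wt Σᵢ|∂ᵢω|²)^{1/2}` (`|v| ≤ M`) and Young is completed in
the integrated quantities; the second keeps its pointwise absorption (`pointwise_budget_B`, `1/8`):
`∫ wt⟪ω, curl W⟫ ≤ ((2κ²+1)/(8ν))·M²·∫wt|ω|²` (`depletedSlice_budget`; `ω = curl v`: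
`depletedSlice_curl`), the case `κ = 1` being rung one's `3/8`. This is the slice form of the
depleted `q = 5/2` budget of `TypeICertificateLadderTargetDepletedBudgetReach.lean` (coefficient
`q(κ_A² + (q−2)κ_B²)/4`, `κ_B = 1`). [folklore: Young bookkeeping]
-/

noncomputable section

open Set Filter Topology MeasureTheory
open scoped RealInnerProductSpace ENNReal NNReal Laplacian ContDiff
open Literature.Analysis.FluidPDE

namespace Summit.NavierStokesRegularity.NavierStokesRegularity.Theorems.FiveHalvesWindow

-- the problem directory repeats the summit name (`NavierStokesRegularity/NavierStokesRegularity`)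
set_option linter.dupNamespace false

open Summit.NavierStokesRegularity.NavierStokesRegularity.Theorems.RungReynoldsOne
open Summit.NavierStokesRegularity.NavierStokesRegularity.Theorems.RungReynoldsOne.WeightedSlice

/-- The weighted viscous density splits as `wt·Σᵢ‖L eᵢ‖² + τ·Σᵢ⟪y, L eᵢ⟫²`. [folklore] -/
theorem visc_density_eq (L : EuclideanSpace ℝ (Fin 3) →L[ℝ] EuclideanSpace ℝ (Fin 3))
    (y : EuclideanSpace ℝ (Fin 3)) (wt τ : ℝ) :
    ∑ i, ⟪L (EuclideanSpace.basisFun (Fin 3) ℝ i),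
        wt • L (EuclideanSpace.basisFun (Fin 3) ℝ i) +
          (τ * ⟪y, L (EuclideanSpace.basisFun (Fin 3) ℝ i)⟫) • y⟫ =
      wt * ∑ i, ‖L (EuclideanSpace.basisFun (Fin 3) ℝ i)‖ ^ 2 +
        τ * ∑ i, ⟪y, L (EuclideanSpace.basisFun (Fin 3) ℝ i)⟫ ^ 2 := by
  rw [Finset.mul_sum, Finset.mul_sum, ← Finset.sum_add_distrib]
  refine Finset.sum_congr rfl fun i _ => ?_
  rw [inner_add_right, real_inner_smul_right, real_inner_smul_right, real_inner_self_eq_norm_sq,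
    real_inner_comm y (L _)]
  ring

/-- The weighted stretching density splits as `wt⟪L y, V⟫ + τ⟪y, L y⟫⟪y, V⟫`. [folklore] -/
theorem str_density_eq (L : EuclideanSpace ℝ (Fin 3) →L[ℝ] EuclideanSpace ℝ (Fin 3))
    (y V : EuclideanSpace ℝ (Fin 3)) (wt τ : ℝ) :
    ⟪wt • L y + (τ * ⟪y, L y⟫) • y, V⟫ = wt * ⟪L y, V⟫ + τ * (⟪y, L y⟫ * ⟪y, V⟫) := by
  rw [inner_add_left, real_inner_smul_left, real_inner_smul_left]
  ring

/-- **Pointwise Young budget of the magnitude piece alone** (`wt = (‖y‖²+1)^{1/4}`,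
`τ = wt/(2(‖y‖²+1))`): `−ντΣᵢ⟪y, L eᵢ⟫² − τ⟪y, L y⟫⟪y, V⟫ ≤ (1/(8ν))‖V‖² wt ‖y‖²`. [folklore] -/
theorem pointwise_budget_B {ν : ℝ} (hν : 0 < ν)
    (L : EuclideanSpace ℝ (Fin 3) →L[ℝ] EuclideanSpace ℝ (Fin 3)) (y V : EuclideanSpace ℝ (Fin 3)) :
    -(ν * ((‖y‖ ^ 2 + 1) ^ (1 / 4 : ℝ) / (2 * (‖y‖ ^ 2 + 1)) *
          ∑ i, ⟪y, L (EuclideanSpace.basisFun (Fin 3) ℝ i)⟫ ^ 2)) -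
        (‖y‖ ^ 2 + 1) ^ (1 / 4 : ℝ) / (2 * (‖y‖ ^ 2 + 1)) * (⟪y, L y⟫ * ⟪y, V⟫) ≤
      1 / (8 * ν) * (‖V‖ ^ 2 * ((‖y‖ ^ 2 + 1) ^ (1 / 4 : ℝ) * ‖y‖ ^ 2)) := by
  set e := EuclideanSpace.basisFun (Fin 3) ℝ with he
  set wt := (‖y‖ ^ 2 + 1) ^ (1 / 4 : ℝ) with hwt
  set τ := wt / (2 * (‖y‖ ^ 2 + 1)) with hτ
  set S := ∑ i, ⟪y, L (e i)⟫ ^ 2 with hS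
  set P := Real.sqrt S with hP
  have hwt0 : 0 ≤ wt := Real.rpow_nonneg (by positivity) _
  have hρ : 0 < ‖y‖ ^ 2 + 1 := by positivity
  have hτ0 : 0 ≤ τ := by positivity
  have hS0 : 0 ≤ S := Finset.sum_nonneg fun i _ => sq_nonneg _
  have hPS : P ^ 2 = S := Real.sq_sqrt hS0
  have hP0 : 0 ≤ P := Real.sqrt_nonneg _
  have hY : |⟪y, L y⟫| ≤ ‖y‖ * P := by
    have hLy : L y = ∑ i, ⟪e i, y⟫ • L (e i) := by
      conv_lhs => rw [← e.sum_repr' y]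
      rw [map_sum]
      simp_rw [map_smul]
    have hexp : ⟪y, L y⟫ = ∑ i, ⟪e i, y⟫ * ⟪y, L (e i)⟫ := by
      rw [hLy, inner_sum]
      simp_rw [real_inner_smul_right]
    have hCS : (∑ i, ⟪e i, y⟫ * ⟪y, L (e i)⟫) ^ 2 ≤ (∑ i, ⟪e i, y⟫ ^ 2) * ∑ i, ⟪y, L (e i)⟫ ^ 2 :=
      Finset.sum_mul_sq_le_sq_mul_sq _ _ _
    rw [e.sum_sq_inner_right y] at hCS
    refine abs_le_of_sq_le_sq ?_ (by positivity)
    rw [hexp, mul_pow, hPS]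
    exact hCS
  have hZ : |⟪y, V⟫| ≤ ‖y‖ * ‖V‖ := abs_real_inner_le_norm _ _
  have hYZ : -(⟪y, L y⟫ * ⟪y, V⟫) ≤ P * (‖y‖ ^ 2 * ‖V‖) := by
    have h0 : -(⟪y, L y⟫ * ⟪y, V⟫) ≤ |⟪y, L y⟫| * |⟪y, V⟫| := by
      rw [← abs_mul]; exact neg_le_abs _
    have h0' : |⟪y, L y⟫| * |⟪y, V⟫| ≤ (‖y‖ * P) * (‖y‖ * ‖V‖) :=
      mul_le_mul hY hZ (abs_nonneg _) (by positivity)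
    have e1 : (‖y‖ * P) * (‖y‖ * ‖V‖) = P * (‖y‖ ^ 2 * ‖V‖) := by ring
    linarith
  have hq := neg_mul_sq_add_mul_le hν P (‖y‖ ^ 2 * ‖V‖)
  have key : -(ν * S) - ⟪y, L y⟫ * ⟪y, V⟫ ≤ (‖y‖ ^ 2 * ‖V‖) ^ 2 / (4 * ν) := by
    rw [← hPS]; linarith
  have h2 : -(ν * (τ * S)) - τ * (⟪y, L y⟫ * ⟪y, V⟫) ≤ τ * ((‖y‖ ^ 2 * ‖V‖) ^ 2 / (4 * ν)) := by
    have h := mul_le_mul_of_nonneg_left key hτ0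
    have e1 : τ * (-(ν * S) - ⟪y, L y⟫ * ⟪y, V⟫) = -(ν * (τ * S)) - τ * (⟪y, L y⟫ * ⟪y, V⟫) := by
      ring
    linarith
  have h3 : τ * ‖y‖ ^ 2 ≤ wt / 2 := by
    rw [hτ, div_mul_eq_mul_div, div_le_div_iff₀ (by positivity) (by norm_num)]
    nlinarith
  have h4 : τ * ((‖y‖ ^ 2 * ‖V‖) ^ 2 / (4 * ν)) ≤ 1 / (8 * ν) * (‖V‖ ^ 2 * (wt * ‖y‖ ^ 2)) := by
    have e1 : τ * ((‖y‖ ^ 2 * ‖V‖) ^ 2 / (4 * ν)) = (τ * ‖y‖ ^ 2) * (‖y‖ ^ 2 * ‖V‖ ^ 2 / (4 * ν)) := by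
      ring
    have hnn : 0 ≤ ‖y‖ ^ 2 * ‖V‖ ^ 2 / (4 * ν) := by positivity
    have e2 := mul_le_mul_of_nonneg_right h3 hnn
    have e3 : wt / 2 * (‖y‖ ^ 2 * ‖V‖ ^ 2 / (4 * ν)) = 1 / (8 * ν) * (‖V‖ ^ 2 * (wt * ‖y‖ ^ 2)) := by
      field_simp
      ring
    linarith
  exact h2.trans h4

/-- **The DEPLETED weighted `L^{5/2}` budget for a solenoidal field** (hypotheses of
`weightedSlice_budget`, plus the depletion of the weighted Lamb pairing with constant `κ`):
`∫ (‖w‖²+1)^{1/4}⟪w, Z⟫ ≤ ((2κ²+1)/(8ν))·M²·∫(‖w‖²+1)^{1/4}‖w‖²`, `Z = νΔw − (v·∇)w + (w·∇)v`. [folklore] -/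
theorem depletedSlice_budget {ν : ℝ} (hν : 0 < ν) {v w Z : EuclideanSpace ℝ (Fin 3) → EuclideanSpace ℝ (Fin 3)}
    (hv : ContDiff ℝ 1 v) (hw : ContDiff ℝ 3 w) (hdiv : VectorCalculus.IsDivFree v)
    (hdivw : ∀ x, VectorCalculus.divergence w x = 0)
    (hZ : ∀ x, Z x = ν • (Δ w) x - fderiv ℝ w x (v x) + fderiv ℝ v x (w x))
    {M B W₀ : ℝ} (hM : ∀ x, ‖v x‖ ≤ M) (hB : ∀ x, ‖fderiv ℝ v x‖ ≤ B)
    (hwt : ∀ x, (‖w x‖ ^ 2 + 1) ^ (1 / 4 : ℝ) ≤ W₀)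
    (l2w : ∫⁻ x, ‖w x‖ₑ ^ 2 < ⊤)
    (l2dw : ∀ i, ∫⁻ x, ‖fderiv ℝ w x (EuclideanSpace.basisFun (Fin 3) ℝ i)‖ₑ ^ 2 < ⊤)
    (l2ddw : ∀ i, ∫⁻ x, ‖fderiv ℝ (fun y => fderiv ℝ w y (EuclideanSpace.basisFun (Fin 3) ℝ i)) x
      (EuclideanSpace.basisFun (Fin 3) ℝ i)‖ₑ ^ 2 < ⊤)
    {κ : ℝ}
    (hdep : |∫ x, (‖w x‖ ^ 2 + 1) ^ (1 / 4 : ℝ) * ⟪fderiv ℝ w x (w x), v x⟫| ≤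
      κ * M * Real.sqrt (∫ x, (‖w x‖ ^ 2 + 1) ^ (1 / 4 : ℝ) * ‖w x‖ ^ 2) *
        Real.sqrt (∫ x, (‖w x‖ ^ 2 + 1) ^ (1 / 4 : ℝ) *
          ∑ i, ‖fderiv ℝ w x (EuclideanSpace.basisFun (Fin 3) ℝ i)‖ ^ 2)) :
    ∫ x, (‖w x‖ ^ 2 + 1) ^ (1 / 4 : ℝ) * ⟪w x, Z x⟫ ≤
      (2 * κ ^ 2 + 1) / (8 * ν) * (M ^ 2 * ∫ x, (‖w x‖ ^ 2 + 1) ^ (1 / 4 : ℝ) * ‖w x‖ ^ 2) := by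
  set e := EuclideanSpace.basisFun (Fin 3) ℝ with he
  have he1 : ∀ i, ‖e i‖ = 1 := fun i => by simp [he]
  have hw2 : ContDiff ℝ 2 w := hw.of_le (by norm_num)
  have hw1 : ContDiff ℝ 1 w := hw.of_le (by norm_num)
  have hdw : Differentiable ℝ w := hw2.differentiable two_ne_zero
  obtain ⟨iLap, iVisc, hVisc⟩ := weightedSlice_viscous hw hwt l2w l2dw l2ddw
  obtain ⟨iTr, hTr⟩ := weightedSlice_transport hv hw2 hdiv hM hB hwt l2w l2dw
  obtain ⟨iStr0, iStr, hStr⟩ := weightedSlice_stretching hv hw2 hdivw hM hB hwt l2w l2dw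
  have hM0 : 0 ≤ M := (norm_nonneg _).trans (hM 0)
  have hW0 : 0 ≤ W₀ := (Real.rpow_nonneg (by positivity) _).trans (hwt 0)
  have cv : Continuous v := hv.continuous
  have cw : Continuous w := hw.continuous
  have cDw : Continuous (fderiv ℝ w) := hw1.continuous_fderiv one_ne_zero
  have cDwe : ∀ i, Continuous fun x => fderiv ℝ w x (e i) := fun i =>
    cDw.clm_apply continuous_const
  have cwt : Continuous fun x => (‖w x‖ ^ 2 + 1) ^ (1 / 4 : ℝ) :=
    ((cw.norm.pow 2).add continuous_const).rpow_const fun x => Or.inr (by norm_num)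
  have cτ : Continuous fun x => (‖w x‖ ^ 2 + 1) ^ (1 / 4 : ℝ) / (2 * (‖w x‖ ^ 2 + 1)) :=
    cwt.div (continuous_const.mul ((cw.norm.pow 2).add continuous_const)) fun x => by positivity
  have hwt0 : ∀ x, 0 ≤ (‖w x‖ ^ 2 + 1) ^ (1 / 4 : ℝ) := fun x => Real.rpow_nonneg (by positivity) _
  set fA : EuclideanSpace ℝ (Fin 3) → ℝ := fun x =>
    (‖w x‖ ^ 2 + 1) ^ (1 / 4 : ℝ) * ∑ i, ‖fderiv ℝ w x (e i)‖ ^ 2 with hfA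
  set fS : EuclideanSpace ℝ (Fin 3) → ℝ := fun x =>
    (‖w x‖ ^ 2 + 1) ^ (1 / 4 : ℝ) / (2 * (‖w x‖ ^ 2 + 1)) * ∑ i, ⟪w x, fderiv ℝ w x (e i)⟫ ^ 2
    with hfS
  set fX : EuclideanSpace ℝ (Fin 3) → ℝ := fun x =>
    (‖w x‖ ^ 2 + 1) ^ (1 / 4 : ℝ) * ⟪fderiv ℝ w x (w x), v x⟫ with hfX
  set fYZ : EuclideanSpace ℝ (Fin 3) → ℝ := fun x =>
    (‖w x‖ ^ 2 + 1) ^ (1 / 4 : ℝ) / (2 * (‖w x‖ ^ 2 + 1)) *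
      (⟪w x, fderiv ℝ w x (w x)⟫ * ⟪w x, v x⟫) with hfYZ
  have hvisc_pt : ∀ x, ∑ i, ⟪fderiv ℝ w x (e i),
      fderiv ℝ (fun y => (‖w y‖ ^ 2 + 1) ^ (1 / 4 : ℝ) • w y) x (e i)⟫ = fA x + fS x := by
    intro x
    simp_rw [fderiv_weightedField_apply (hdw x)]
    exact visc_density_eq (fderiv ℝ w x) (w x) _ _
  have hstr_pt : ∀ x, ⟪fderiv ℝ (fun y => (‖w y‖ ^ 2 + 1) ^ (1 / 4 : ℝ) • w y) x (w x), v x⟫ =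
      fX x + fYZ x := by
    intro x
    rw [fderiv_weightedField_apply (hdw x)]
    exact str_density_eq (fderiv ℝ w x) (w x) (v x) _ _
  have isq : ∀ i, Integrable (fun x => ‖fderiv ℝ w x (e i)‖ ^ 2) volume := fun i =>
    integrable_sq_norm_of_lintegral_lt_top (cDwe i) (l2dw i)
  have iA : Integrable fA volume := by
    have isum : Integrable (fun x => ∑ i, ‖fderiv ℝ w x (e i)‖ ^ 2) volume :=
      integrable_finsetSum _ fun i _ => isq i
    refine Integrable.mono' (isum.const_mul W₀) (cwt.mul (continuous_finsetSum _ fun i _ =>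
      (cDwe i).norm.pow 2)).aestronglyMeasurable (Eventually.of_forall fun x => ?_)
    have hs0 : 0 ≤ ∑ i, ‖fderiv ℝ w x (e i)‖ ^ 2 := Finset.sum_nonneg fun i _ => sq_nonneg _
    rw [hfA]
    simp only
    rw [Real.norm_of_nonneg (mul_nonneg (hwt0 x) hs0)]
    exact mul_le_mul_of_nonneg_right (hwt x) hs0
  have iS : Integrable fS volume := by
    have h := iVisc.sub iA
    refine h.congr (Eventually.of_forall fun x => ?_)
    simp only [Pi.sub_apply]
    rw [hvisc_pt x]
    ring
  have iX : Integrable fX volume := by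
    -- `|fX| ≤ Σᵢ W₀ M ‖w‖ ‖∂ᵢw‖`, each summand a product of two `L²` functions
    have ib : ∀ i, Integrable (fun x => W₀ * M * (‖w x‖ * ‖fderiv ℝ w x (e i)‖)) volume := by
      intro i
      refine integrable_of_norm_le_const_mul_mul (W₀ * M) ?_ cw (cDwe i) l2w (l2dw i) fun x => ?_
      · exact continuous_const.mul (cw.norm.mul (cDwe i).norm)
      · rw [Real.norm_of_nonneg (by positivity)]
        ring_nf
        rfl
    have isum : Integrable (fun x => ∑ i, W₀ * M * (‖w x‖ * ‖fderiv ℝ w x (e i)‖)) volume :=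
      integrable_finsetSum _ fun i _ => ib i
    refine Integrable.mono' isum ((cwt.mul ((cDw.clm_apply cw).inner cv))).aestronglyMeasurable
      (Eventually.of_forall fun x => ?_)
    rw [hfX]
    simp only
    rw [norm_mul, Real.norm_of_nonneg (hwt0 x)]
    -- `‖Dw(w)‖ ≤ Σᵢ |wᵢ| ‖Dw eᵢ‖ ≤ ‖w‖ Σᵢ ‖Dw eᵢ‖`
    have hLy : fderiv ℝ w x (w x) = ∑ i, ⟪e i, w x⟫ • fderiv ℝ w x (e i) := by
      conv_lhs => rw [← e.sum_repr' (w x)]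
      rw [map_sum]
      simp_rw [map_smul]
    have hnorm : ‖fderiv ℝ w x (w x)‖ ≤ ∑ i, ‖w x‖ * ‖fderiv ℝ w x (e i)‖ := by
      rw [hLy]
      refine (norm_sum_le _ _).trans (Finset.sum_le_sum fun i _ => ?_)
      rw [norm_smul]
      refine mul_le_mul_of_nonneg_right ?_ (norm_nonneg _)
      have := abs_real_inner_le_norm (e i) (w x)
      rw [he1, one_mul] at this
      exact this
    have hin : ‖⟪fderiv ℝ w x (w x), v x⟫‖ ≤ ‖fderiv ℝ w x (w x)‖ * M :=
      (norm_inner_le_norm _ _).trans (mul_le_mul_of_nonneg_left (hM x) (norm_nonneg _))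
    calc (‖w x‖ ^ 2 + 1) ^ (1 / 4 : ℝ) * ‖⟪fderiv ℝ w x (w x), v x⟫‖
        ≤ W₀ * ((∑ i, ‖w x‖ * ‖fderiv ℝ w x (e i)‖) * M) := by
          refine mul_le_mul (hwt x) (hin.trans ?_) (norm_nonneg _) hW0
          exact mul_le_mul_of_nonneg_right hnorm hM0
      _ = ∑ i, W₀ * M * (‖w x‖ * ‖fderiv ℝ w x (e i)‖) := by
          rw [Finset.sum_mul, Finset.mul_sum]
          refine Finset.sum_congr rfl fun i _ => ?_
          ring
  have iYZ : Integrable fYZ volume := by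
    have h := iStr.sub iX
    refine h.congr (Eventually.of_forall fun x => ?_)
    simp only [Pi.sub_apply]
    rw [hstr_pt x]
    ring
  have iwsq : Integrable (fun x => (‖w x‖ ^ 2 + 1) ^ (1 / 4 : ℝ) * ‖w x‖ ^ 2) volume := by
    have isqw : Integrable (fun x => ‖w x‖ ^ 2) volume := integrable_sq_norm_of_lintegral_lt_top cw l2w
    refine Integrable.mono' (isqw.const_mul W₀) (cwt.mul (cw.norm.pow 2)).aestronglyMeasurable
      (Eventually.of_forall fun x => ?_)
    rw [Real.norm_of_nonneg (mul_nonneg (hwt0 x) (sq_nonneg _))]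
    exact mul_le_mul_of_nonneg_right (hwt x) (sq_nonneg _)
  set D : ℝ := ∫ x, fA x with hD
  set Y : ℝ := ∫ x, (‖w x‖ ^ 2 + 1) ^ (1 / 4 : ℝ) * ‖w x‖ ^ 2 with hY
  have hD0 : 0 ≤ D := integral_nonneg fun x => mul_nonneg (hwt0 x)
    (Finset.sum_nonneg fun i _ => sq_nonneg _)
  have hY0 : 0 ≤ Y := integral_nonneg fun x => mul_nonneg (hwt0 x) (sq_nonneg _)
  have hfun : (fun x => (‖w x‖ ^ 2 + 1) ^ (1 / 4 : ℝ) * ⟪w x, Z x⟫) = fun x =>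
      ν * ⟪(Δ w) x, (‖w x‖ ^ 2 + 1) ^ (1 / 4 : ℝ) • w x⟫ -
        (‖w x‖ ^ 2 + 1) ^ (1 / 4 : ℝ) * ⟪w x, fderiv ℝ w x (v x)⟫ +
        (‖w x‖ ^ 2 + 1) ^ (1 / 4 : ℝ) * ⟪w x, fderiv ℝ v x (w x)⟫ := by
    funext x
    have hc : ⟪(Δ w) x, (‖w x‖ ^ 2 + 1) ^ (1 / 4 : ℝ) • w x⟫ =
        (‖w x‖ ^ 2 + 1) ^ (1 / 4 : ℝ) * ⟪w x, (Δ w) x⟫ := by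
      rw [real_inner_smul_right, real_inner_comm]
    rw [hc, hZ x]
    simp only [inner_add_right, inner_sub_right, real_inner_smul_right]
    ring
  have iAB : Integrable (fun x => ν * ⟪(Δ w) x, (‖w x‖ ^ 2 + 1) ^ (1 / 4 : ℝ) • w x⟫ -
      (‖w x‖ ^ 2 + 1) ^ (1 / 4 : ℝ) * ⟪w x, fderiv ℝ w x (v x)⟫) volume :=
    (iLap.const_mul ν).sub iTr
  rw [hfun, integral_add iAB iStr0, integral_sub (iLap.const_mul ν) iTr,
    integral_const_mul, hVisc, hTr, hStr, sub_zero]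
  have hViscSplit : ∫ x, ∑ i, ⟪fderiv ℝ w x (e i),
      fderiv ℝ (fun y => (‖w y‖ ^ 2 + 1) ^ (1 / 4 : ℝ) • w y) x (e i)⟫ = D + ∫ x, fS x := by
    rw [hD, ← integral_add iA iS]
    exact integral_congr_ae (Eventually.of_forall hvisc_pt)
  have hStrSplit : ∫ x, ⟪fderiv ℝ (fun y => (‖w y‖ ^ 2 + 1) ^ (1 / 4 : ℝ) • w y) x (w x), v x⟫ =
      (∫ x, fX x) + ∫ x, fYZ x := by
    rw [← integral_add iX iYZ]
    exact integral_congr_ae (Eventually.of_forall hstr_pt)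
  rw [hViscSplit, hStrSplit]
  -- piece A: global Young from the depletion hypothesis
  have hApiece : -(ν * D) - ∫ x, fX x ≤ κ ^ 2 * M ^ 2 * Y / (4 * ν) := by
    have habs : -(∫ x, fX x) ≤ κ * M * Real.sqrt Y * Real.sqrt D := by
      have h1 := neg_le_abs (∫ x, fX x)
      have h2 : |∫ x, fX x| ≤ κ * M * Real.sqrt Y * Real.sqrt D := hdep
      linarith
    have hq := neg_mul_sq_add_mul_le hν (Real.sqrt D) (κ * M * Real.sqrt Y)
    rw [Real.sq_sqrt hD0] at hq
    have hsq : (κ * M * Real.sqrt Y) ^ 2 = κ ^ 2 * M ^ 2 * Y := by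
      rw [mul_pow, mul_pow, Real.sq_sqrt hY0]
    rw [hsq] at hq
    nlinarith [hq, habs]
  -- piece B: pointwise Young, then `‖v‖² ≤ M²`
  have hBpiece : -(ν * ∫ x, fS x) - ∫ x, fYZ x ≤ 1 / (8 * ν) * (M ^ 2 * Y) := by
    have hpt : ∀ x, -(ν * fS x) - fYZ x ≤
        1 / (8 * ν) * (‖v x‖ ^ 2 * ((‖w x‖ ^ 2 + 1) ^ (1 / 4 : ℝ) * ‖w x‖ ^ 2)) := fun x =>
      pointwise_budget_B hν (fderiv ℝ w x) (w x) (v x)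
    have hpt' : ∀ x, -(ν * fS x) - fYZ x ≤
        1 / (8 * ν) * M ^ 2 * ((‖w x‖ ^ 2 + 1) ^ (1 / 4 : ℝ) * ‖w x‖ ^ 2) := by
      intro x
      refine (hpt x).trans ?_
      have hvx : ‖v x‖ ^ 2 ≤ M ^ 2 := pow_le_pow_left₀ (norm_nonneg _) (hM x) 2
      have hw0' : 0 ≤ (‖w x‖ ^ 2 + 1) ^ (1 / 4 : ℝ) * ‖w x‖ ^ 2 := mul_nonneg (hwt0 x) (sq_nonneg _)
      have hν' : 0 ≤ 1 / (8 * ν) := by positivity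
      nlinarith [mul_le_mul_of_nonneg_right hvx hw0']
    have ineg : Integrable (fun x => -(ν * fS x)) volume := (iS.const_mul ν).neg
    have ilhs : Integrable (fun x => -(ν * fS x) - fYZ x) volume := ineg.sub iYZ
    have hint : ∫ x, (-(ν * fS x) - fYZ x) ≤
        ∫ x, 1 / (8 * ν) * M ^ 2 * ((‖w x‖ ^ 2 + 1) ^ (1 / 4 : ℝ) * ‖w x‖ ^ 2) :=
      integral_mono ilhs (iwsq.const_mul (1 / (8 * ν) * M ^ 2)) hpt'
    have hl : ∫ x, (-(ν * fS x) - fYZ x) = -(ν * ∫ x, fS x) - ∫ x, fYZ x := by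
      rw [integral_sub ineg iYZ, integral_neg, integral_const_mul]
    have hr : ∫ x, 1 / (8 * ν) * M ^ 2 * ((‖w x‖ ^ 2 + 1) ^ (1 / 4 : ℝ) * ‖w x‖ ^ 2) =
        1 / (8 * ν) * M ^ 2 * Y := integral_const_mul _ _
    rw [hl, hr] at hint
    have e1 : 1 / (8 * ν) * M ^ 2 * Y = 1 / (8 * ν) * (M ^ 2 * Y) := by ring
    linarith
  have e2 : (2 * κ ^ 2 + 1) / (8 * ν) * (M ^ 2 * Y) =
      κ ^ 2 * M ^ 2 * Y / (4 * ν) + 1 / (8 * ν) * (M ^ 2 * Y) := by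
    field_simp
    ring
  rw [e2]
  have e3 : ν * -(D + ∫ x, fS x) + -((∫ x, fX x) + ∫ x, fYZ x) =
      (-(ν * D) - ∫ x, fX x) + (-(ν * ∫ x, fS x) - ∫ x, fYZ x) := by ring
  rw [e3]
  exact add_le_add hApiece hBpiece

/-- Monotonicity in the constant: the depleted slice bound with any `c ≥ (2κ²+1)/8`. -/
theorem depletedSlice_budget_of_le {ν : ℝ} (hν : 0 < ν) {κ c M Y L : ℝ} (hY : 0 ≤ Y)
    (hc : (2 * κ ^ 2 + 1) / 8 ≤ c) (h : L ≤ (2 * κ ^ 2 + 1) / (8 * ν) * (M ^ 2 * Y)) :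
    L ≤ c / ν * (M ^ 2 * Y) := by
  refine h.trans ?_
  have h1 : (2 * κ ^ 2 + 1) / (8 * ν) = (2 * κ ^ 2 + 1) / 8 / ν := by
    rw [div_div]
  rw [h1]
  exact mul_le_mul_of_nonneg_right (div_le_div_of_nonneg_right hc hν.le) (by positivity)

/-- **The depleted weighted `L^{5/2}` vorticity slice inequality** (`ω = curl v`, vorticity equation
`curl W = νΔω − (v·∇)ω + (ω·∇)v`, depletion instance for `v` with constant `κ`):
`∫(|ω|²+1)^{1/4}⟪ω, curl W⟫ ≤ (c/ν)·M²·∫(|ω|²+1)^{1/4}|ω|²` for every `c ≥ (2κ²+1)/8`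
(rung one's `stub_weightedVorticitySlice`: `κ = 1`, `c = 3/8`). [folklore] -/
theorem depletedSlice_curl {ν : ℝ} (hν : 0 < ν) {κ c : ℝ} (hc : (2 * κ ^ 2 + 1) / 8 ≤ c)
    {v W : EuclideanSpace ℝ (Fin 3) → EuclideanSpace ℝ (Fin 3)}
    (hv : ContDiff ℝ ∞ v) (hdiv : VectorCalculus.IsDivFree v)
    (hcurl : ∀ x, curl W x = ν • (Δ (curl v)) x - convect v (curl v) x + convect (curl v) v x)
    {M B : ℝ} (hM : ∀ x, ‖v x‖ ≤ M) (hB : ∀ x, ‖fderiv ℝ v x‖ ≤ B)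
    (h1 : ∫⁻ x, ‖iteratedFDeriv ℝ 1 v x‖ₑ ^ 2 < ⊤) (h2 : ∫⁻ x, ‖iteratedFDeriv ℝ 2 v x‖ₑ ^ 2 < ⊤)
    (h3 : ∫⁻ x, ‖iteratedFDeriv ℝ 3 v x‖ₑ ^ 2 < ⊤)
    (hdep : |∫ x, (‖curl v x‖ ^ 2 + 1) ^ (1 / 4 : ℝ) * ⟪fderiv ℝ (curl v) x (curl v x), v x⟫| ≤
      κ * M * Real.sqrt (∫ x, (‖curl v x‖ ^ 2 + 1) ^ (1 / 4 : ℝ) * ‖curl v x‖ ^ 2) *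
        Real.sqrt (∫ x, (‖curl v x‖ ^ 2 + 1) ^ (1 / 4 : ℝ) *
          ∑ i, ‖fderiv ℝ (curl v) x (EuclideanSpace.basisFun (Fin 3) ℝ i)‖ ^ 2)) :
    ∫ x, (‖curl v x‖ ^ 2 + 1) ^ (1 / 4 : ℝ) * ⟪curl v x, curl W x⟫ ≤
      c / ν * (M ^ 2 * ∫ x, (‖curl v x‖ ^ 2 + 1) ^ (1 / 4 : ℝ) * ‖curl v x‖ ^ 2) := by
  set e := EuclideanSpace.basisFun (Fin 3) ℝ with he
  have he1 : ∀ i, ‖e i‖ = 1 := fun i => by simp [he]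
  have hDv : ContDiff ℝ ∞ (fderiv ℝ v) := (contDiff_infty_iff_fderiv.1 hv).2
  have hω : ContDiff ℝ ∞ (curl v) := by
    rw [curl_eq_curlCLM_comp]
    exact curlCLM.contDiff.comp hDv
  have hω3 : ContDiff ℝ 3 (curl v) := hω.of_le (by norm_cast)
  have hω2 : ContDiff ℝ 2 (curl v) := hω.of_le (by norm_cast)
  have hv1 : ContDiff ℝ 1 v := hv.of_le (by norm_cast)
  have hv2 : ContDiff ℝ 2 v := hv.of_le (by norm_cast)
  have hdivω : ∀ x, VectorCalculus.divergence (curl v) x = 0 := fun x =>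
    divergence_curl_eq_zero_holds v hv2 x
  have hZ : ∀ x, curl W x =
      ν • (Δ (curl v)) x - fderiv ℝ (curl v) x (v x) + fderiv ℝ v x (curl v x) := hcurl
  have nω : ∀ x, ‖curl v x‖ ≤ ‖curlCLM‖ * B := fun x =>
    (norm_curl_le v x).trans (mul_le_mul_of_nonneg_left (hB x) (norm_nonneg curlCLM))
  have hwt : ∀ x, (‖curl v x‖ ^ 2 + 1) ^ (1 / 4 : ℝ) ≤ (‖curlCLM‖ * B) ^ 2 + 1 := fun x =>
    (weight_le (curl v x)).trans (by
      have := pow_le_pow_left₀ (norm_nonneg _) (nω x) 2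
      linarith)
  have l2ω : ∫⁻ x, ‖curl v x‖ₑ ^ 2 < ⊤ := by
    refine lintegral_enorm_sq_lt_top_of_norm_le_const_mul ‖curlCLM‖ (fun x => ?_) h1
    rw [← norm_iteratedFDeriv_fderiv, norm_iteratedFDeriv_zero]
    exact norm_curl_le v x
  have l2dω : ∀ i, ∫⁻ x, ‖fderiv ℝ (curl v) x (e i)‖ₑ ^ 2 < ⊤ := fun i => by
    refine lintegral_enorm_sq_lt_top_of_norm_le_const_mul ‖curlCLM‖ (fun x => ?_) h2
    calc ‖fderiv ℝ (curl v) x (e i)‖ ≤ ‖fderiv ℝ (curl v) x‖ := by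
          simpa [he1] using (fderiv ℝ (curl v) x).le_opNorm (e i)
      _ ≤ ‖curlCLM‖ * ‖iteratedFDeriv ℝ 2 v x‖ := norm_fderiv_curl_le hv2 x
  have l2ddω : ∀ i, ∫⁻ x, ‖fderiv ℝ (fun y => fderiv ℝ (curl v) y (e i)) x (e i)‖ₑ ^ 2 < ⊤ :=
      fun i => by
    refine lintegral_enorm_sq_lt_top_of_norm_le_const_mul ‖curlCLM‖ (fun x => ?_) h3
    calc ‖fderiv ℝ (fun y => fderiv ℝ (curl v) y (e i)) x (e i)‖
        ≤ ‖iteratedFDeriv ℝ 2 (curl v) x‖ := norm_fderiv_fderiv_apply_basisFun_le hω2 x i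
      _ ≤ ‖curlCLM‖ * ‖iteratedFDeriv ℝ 3 v x‖ := by
          rw [curl_eq_curlCLM_comp, curlCLM.iteratedFDeriv_comp_left (hDv.contDiffAt (x := x))
            (i := 2) (by norm_cast), ← norm_iteratedFDeriv_fderiv]
          exact ContinuousLinearMap.norm_compContinuousMultilinearMap_le _ _
  have hY0 : 0 ≤ ∫ x, (‖curl v x‖ ^ 2 + 1) ^ (1 / 4 : ℝ) * ‖curl v x‖ ^ 2 :=
    integral_nonneg fun x => mul_nonneg (Real.rpow_nonneg (by positivity) _) (sq_nonneg _)
  exact depletedSlice_budget_of_le hν hY0 hc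
    (depletedSlice_budget hν hv1 hω3 hdiv hdivω hZ hM hB hwt l2ω l2dω l2ddω hdep)

end Summit.NavierStokesRegularity.NavierStokesRegularity.Theorems.FiveHalvesWindow

end
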